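import Literature.Probability.Percolation.FiveMarkedLoopRungHexBall1
import Literature.Probability.Percolation.TriSiteHalfCounting
import HarnessLib

/-!
# The five-point normalisation (N) decided on the smallest five-marked domain `hexBall1Five`

Topic `Literature/Probability/Percolation` (site percolation on `𝕋` at `p = 1/2`; continues
`FiveMarkedLoopRungHexBall1.lean`, whose tables and index closures it reuses). Objects: `FiveMarkedLoops.lean` (the
interface part `InInterface`, the joined set `Joined`, the mid-edge probability `midEdgeProb D r c x x'` = `P_{1/2}` that
a face of the inner `H_G`-edge `{x, x'}` is joined to the corner face `y_r` off the interfaces, under the five-point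
boundary condition `(r, c)`); the counting form of `P_{1/2}` (`TriSiteHalfCounting.lean`); the locality lemmas
`joined_inter_iff` (`FiveMarkedLoopStubs.lean`). Sources: M. Khristoforov, S. Smirnov, *Percolation and O(1) loop model*,
arXiv:2111.15612 (2021), §1 (the programme announces six-disorder generalisations of Lemma 2 without stating them);
B. Bollobás, O. Riordan, *Percolation* (CUP 2006), Ch. 7, proof of Lemma 6, p. 175 (the counting measure at `p = 1/2`).

THE THEOREM (`hexFivePointNormalisation_hexBall1Five`): for every colour `c` and every inner edge `{x, x'}` of `H_G` on
`hexBall1Five` (`x` an interior face, `x'` adjacent across a bond of `G`),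
`∑ r : Fin 5, midEdgeProb hexBall1Five r c x x' = 1` — the lane's typed five-point normalisation conjecture (N)
(b-engine-2, D6′ pilot: exact on 3 888/3 888 checks of the 44-hexagon rhombus) SPECIALISED to the smallest domain and
DECIDED by the kernel on standard axioms (ten `decide +kernel`: 2 colours × 5 corners, each over `2⁷` colourings and the
18 ordered inner edges). Chain: `midEdgeProb_eq_card_div` (counting form + locality), index evaluators for the interface
part and the joined set with re-checked closedness flags and their renderings `inInterface_iff_ip` / `joined_iff_j`
(the arguments of `S0.inInterface_iff` / `S0.joined_iff` on indices), the bijection `allBits 7 ≃ 𝒫(triBall 1)`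
(`card_filter_powerset_eq_countP`), a column tally, and the 5 × 18 table of per-corner counts `nExpected` (every column
sums to `128 = 2⁷`; three independent enumeration codes agree with it).

Status in print (lane wording, lit-2 g12): (N) is NOT printed — Khristoforov–Smirnov 2021 §1 announce six-disorder
generalisations without a statement; this is the first theorem-shaped instance, kernel-decided on the smallest
five-marked domain (C-class computational content, standard axioms, no `native_decide`); the locality/counting half is
general (every domain).
-/

noncomputable section

open Finset




namespace Literature.Probability.Percolation.FivePoint.Rung

open Literature.Probability.LatticeModels Literature.Probability.Percolation.FivePoint.S0

/-! ### N1. Index evaluator for the interface part and the joined set -/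

/-- Source indices of the interface part: the corner faces `y_j`, `j ≠ r`. [cite: BollobasRiordan2006, Ch. 7 §7.2.2 pp. 168–171] -/
def ipSrc (r : Fin 5) : List ℕ := ((List.finRange 5).filter fun j => j ≠ r).map cornerIdx

/-- The interface part `IP_{r,c}(S)` as face indices: closure of the four corner faces `j ≠ r` under bicoloured
adjacencies (completeness re-checked by `closedF`). [cite: BollobasRiordan2006, Ch. 7 §7.2.2 pp. 168–171] -/
def ipClos (cfg : List Bool) (r : Fin 5) (c : Bool) : List ℕ := closGo cfg r c 40 (ipSrc r) (ipSrc r)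

/-- Worklist closure along `H_G`-adjacencies (the tabulated ones) through faces OFF the index set `IP`. [cite: BollobasRiordan2006, Ch. 7 §7.2.2 pp. 168–171] -/
def hGo (IP : List ℕ) : ℕ → List ℕ → List ℕ → List ℕ
  | 0, R, _ => R
  | _ + 1, R, [] => R
  | fuel + 1, R, x :: st =>
    let new := (adjL.getD x []).filterMap fun e =>
      if !IP.elem e.j && !R.elem e.j then some e.j else none
    hGo IP fuel (R ++ new) (st ++ new)

/-- Closedness of `R` under tabulated `H_G`-adjacencies off `IP`. [cite: BollobasRiordan2006, Ch. 7 §7.2.2 pp. 168–171] -/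
def hClosed (IP R : List ℕ) : Bool :=
  edgeTab.all fun e => IP.elem e.i || IP.elem e.j || !R.elem e.i || R.elem e.j

/-- The joined set `J_{r,c}(S)` as face indices: empty if `y_r` lies on the interface part, else the closure of
`y_r` off the interface part. [cite: BollobasRiordan2006, Ch. 7 §7.2.2 pp. 168–171] -/
def jClos (cfg : List Bool) (r : Fin 5) (c : Bool) : List ℕ :=
  if (ipClos cfg r c).elem (cornerIdx r) then [] else hGo (ipClos cfg r c) 40 [cornerIdx r] [cornerIdx r]

/-- Both closedness flags of the instance `(cfg, r, c)`. [cite: BollobasRiordan2006, Ch. 7 §7.2.2 pp. 168–171] -/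
def nFlags (cfg : List Bool) (r : Fin 5) (c : Bool) : Bool :=
  closedF cfg r c (ipClos cfg r c) && hClosed (ipClos cfg r c) (jClos cfg r c)

/-! ### N2. The inner edges of `H_G` and the tally -/

/-- The 18 ordered inner edges `{x, x'}` of `H_G` on `hexBall1Five` (`x` an interior face, `x'` adjacent across a bond of
`G`), as face indices (`innerTab_complete`). [cite: BollobasRiordan2006, Ch. 7 §7.2.2 pp. 168–171] -/
def innerTab : List (ℕ × ℕ) :=
  [(7, 6), (7, 8), (7, 14), (8, 2), (8, 7), (8, 9), (9, 8), (9, 10), (9, 16), (14, 7), (14, 13), (14, 15), (15, 14), (15, 16), (15, 21), (16, 9), (16, 15), (16, 17)]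

/-- Add a row of Booleans to a list of counters. [cite: BollobasRiordan2006, Ch. 7 §7.2.2 pp. 168–171] -/
def addRow (acc : List ℕ) (row : List Bool) : List ℕ := List.zipWith (fun a b => if b then a + 1 else a) acc row

/-- Column counts of a list of Boolean rows of length `n`. [cite: BollobasRiordan2006, Ch. 7 §7.2.2 pp. 168–171] -/
def tally (rows : List (List Bool)) (n : ℕ) : List ℕ := rows.foldl addRow (List.replicate n 0)

/-- All `(configuration, reference corner)` pairs. [cite: BollobasRiordan2006, Ch. 7 §7.2.2 pp. 168–171] -/
def cfgPairs : List (List Bool × Fin 5) :=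
  (List.finRange 5).flatMap fun r => (allBits 7).map fun cfg => (cfg, r)

/-- The row of the instance `(cfg, r)` under colour `c`: for each inner edge, is one of its two faces joined to `y_r`? [cite: BollobasRiordan2006, Ch. 7 §7.2.2 pp. 168–171] -/
def nRow (c : Bool) (p : List Bool × Fin 5) : List Bool :=
  let J := jClos p.1 p.2 c
  innerTab.map fun e => J.elem e.1 || J.elem e.2

/-- The column counts at `(c, r)`: for each inner edge, the number of configurations `S ⊆ G` under which one of its
two faces is joined to `y_r`. [cite: BollobasRiordan2006, Ch. 7 §7.2.2 pp. 168–171] -/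
def nTallyAt (c : Bool) (r : Fin 5) : List ℕ := tally ((allBits 7).map fun cfg => nRow c (cfg, r)) innerTab.length

/-- All flags at `(c, r)`. [cite: BollobasRiordan2006, Ch. 7 §7.2.2 pp. 168–171] -/
def nFlagsAt (c : Bool) (r : Fin 5) : Bool := (allBits 7).all fun cfg => nFlags cfg r c

/-- The expected column counts (enumeration side, `n5_check.py`; identical for both colours by the colour-flip
symmetry): entry `k` of row `r` = number of `S ⊆ triBall 1` under which a face of the `k`-th inner edge is joined to
`y_r`; every COLUMN sums to `128 = 2⁷`. [cite: BollobasRiordan2006, Ch. 7 §7.2.2 pp. 168–171] -/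
def nExpected (_c : Bool) (r : Fin 5) : List ℕ :=
  ![[16, 19, 28, 13, 19, 20, 20, 18, 32, 28, 35, 40, 40, 44, 55, 32, 44, 46],
    [9, 15, 12, 14, 15, 26, 26, 41, 34, 12, 9, 15, 15, 26, 14, 34, 26, 41],
    [16, 28, 18, 42, 28, 36, 36, 42, 28, 18, 15, 18, 18, 18, 15, 28, 18, 16],
    [41, 34, 26, 41, 34, 26, 26, 14, 15, 26, 14, 15, 15, 12, 9, 15, 12, 9],
    [46, 32, 44, 18, 32, 20, 20, 13, 19, 44, 55, 40, 40, 28, 35, 19, 28, 16]] r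

/-- **The (N) checker at `(c, r)`**: flags, and the column counts equal the expected table `nExpected c r`. [cite: BollobasRiordan2006, Ch. 7 §7.2.2 pp. 168–171] -/
def nCheckAt (c : Bool) (r : Fin 5) : Bool := nFlagsAt c r && (nTallyAt c r == nExpected c r)

end Literature.Probability.Percolation.FivePoint.Rung

namespace Literature.Probability.Percolation.FivePoint.Rung

open Literature.Probability.LatticeModels Literature.Probability.Percolation.FivePoint.S0

/-! ### N3. Soundness of the interface-part evaluator -/

/-- A face set given by in-range indices with a valid closedness flag is closed under the real `IStepS`. [cite: BollobasRiordan2006, Ch. 7 §7.2.2 pp. 168–171] -/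
theorem closedF_sound (S : Finset (Site 2)) (r : Fin 5) (c : Bool) {R : List ℕ} (hR : ∀ x ∈ R, x < 24)
    (hcl : closedF (encode S) r c R = true) :
    ∀ F ∈ (R.map faceAt).toFinset, ∀ F', IStepS S r c F F' → F' ∈ (R.map faceAt).toFinset := by
  intro F hF F' hst
  rw [List.mem_toFinset, List.mem_map] at hF ⊢
  obtain ⟨x, hx, rfl⟩ := hF
  obtain ⟨e, he, hei, hej, hb⟩ := exists_edge_of_iStepS S r c (hR x hx) hst
  refine ⟨e.j, ?_, hej⟩
  have := (List.all_eq_true.1 hcl) e he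
  simp [hb] at this
  exact this.resolve_left (fun h => h (hei ▸ hx))

/-- The interface sources are the corner indices `j ≠ r`. [cite: BollobasRiordan2006, Ch. 7 §7.2.2 pp. 168–171] -/
theorem mem_ipSrc {r : Fin 5} {x : ℕ} : x ∈ ipSrc r ↔ ∃ j : Fin 5, j ≠ r ∧ cornerIdx j = x := by
  simp [ipSrc]

/-- Indices of the interface part are in range. [cite: BollobasRiordan2006, Ch. 7 §7.2.2 pp. 168–171] -/
theorem ipClos_lt (cfg : List Bool) (r : Fin 5) (c : Bool) : ∀ x ∈ ipClos cfg r c, x < 24 := by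
  have hsrc : ∀ x ∈ ipSrc r, x < 24 := by
    intro x hx
    obtain ⟨j, -, rfl⟩ := mem_ipSrc.1 hx
    exact cornerIdx_lt j
  exact closGo_inv cfg r c (· < 24) (fun e he _ _ => (edgeTab_lt e he).2) 40 _ _ hsrc hsrc

/-- Every face of the interface-part evaluator is linked to a corner `y_j`, `j ≠ r`, through bicoloured edges. [cite: BollobasRiordan2006, Ch. 7 §7.2.2 pp. 168–171] -/
theorem ipClos_reach (S : Finset (Site 2)) (r : Fin 5) (c : Bool) :
    ∀ x ∈ ipClos (encode S) r c, ∃ j : Fin 5, j ≠ r ∧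
      Relation.ReflTransGen (IStepS S r c) (cornerT j) (faceAt x) := by
  have hsrc : ∀ x ∈ ipSrc r, ∃ j : Fin 5, j ≠ r ∧
      Relation.ReflTransGen (IStepS S r c) (cornerT j) (faceAt x) := by
    intro x hx
    obtain ⟨j, hj, rfl⟩ := mem_ipSrc.1 hx
    exact ⟨j, hj, by rw [faceAt_cornerIdx]⟩
  refine closGo_inv (encode S) r c
    (fun x => ∃ j : Fin 5, j ≠ r ∧ Relation.ReflTransGen (IStepS S r c) (cornerT j) (faceAt x))
    (fun e he hb hi => ?_) 40 _ _ hsrc hsrc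
  obtain ⟨j, hj, hreach⟩ := hi
  exact ⟨j, hj, hreach.tail (iStepS_of_bicolE S r c he hb)⟩

/-- **The interface part rendered**: under the closedness flag, `InInterface hexBall1Five ↑S r c F` iff `F` is a face
of the evaluator's interface part. [cite: BollobasRiordan2006, Ch. 7 §7.2.2 pp. 168–171] -/
theorem inInterface_iff_ip (S : Finset (Site 2)) (r : Fin 5) (c : Bool)
    (hcl : closedF (encode S) r c (ipClos (encode S) r c) = true) (F : HexVertex) :
    InInterface hexBall1Five (↑S) r c F ↔ F ∈ ((ipClos (encode S) r c).map faceAt).toFinset := by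
  constructor
  · rintro ⟨j, hj, Y, hY, hreach⟩
    rw [isCornerFace_iff] at hY
    subst hY
    rw [iStep_eq_S] at hreach
    refine reach_mem_of_closed (src := {cornerT j}) ?_ (closedF_sound S r c (ipClos_lt _ r c) hcl)
      (Finset.mem_singleton_self _) hreach
    intro F hF
    rw [Finset.mem_singleton] at hF
    subst hF
    rw [List.mem_toFinset, List.mem_map]
    exact ⟨cornerIdx j, src_mem_closGo _ _ _ _ _ _ _ (mem_ipSrc.2 ⟨j, hj, rfl⟩), faceAt_cornerIdx j⟩
  · intro hF
    rw [List.mem_toFinset, List.mem_map] at hF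
    obtain ⟨x, hx, rfl⟩ := hF
    obtain ⟨j, hj, hreach⟩ := ipClos_reach S r c x hx
    refine ⟨j, hj, cornerT j, (isCornerFace_iff j _).2 rfl, ?_⟩
    rw [iStep_eq_S]; exact hreach

/-- Index form: for a tabulated face, membership in the interface part is membership of its index. [cite: BollobasRiordan2006, Ch. 7 §7.2.2 pp. 168–171] -/
theorem inInterface_faceAt_iff (S : Finset (Site 2)) (r : Fin 5) (c : Bool)
    (hcl : closedF (encode S) r c (ipClos (encode S) r c) = true) {i : ℕ} (hi : i < 24) :
    InInterface hexBall1Five (↑S) r c (faceAt i) ↔ i ∈ ipClos (encode S) r c := by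
  rw [inInterface_iff_ip S r c hcl, List.mem_toFinset, List.mem_map]
  constructor
  · rintro ⟨x, hx, hxe⟩
    rwa [faceAt_inj x (ipClos_lt _ r c x hx) i hi hxe] at hx
  · exact fun h => ⟨i, h, rfl⟩

/-! ### N4. Soundness of the joined-set evaluator -/

/-- Every tabulated adjacency has an endpoint of its common edge in the ball (so it is an `H_G`-step). [cite: BollobasRiordan2006, Ch. 7 §7.2.2 pp. 168–171] -/
theorem edgeTab_in : ∀ e ∈ edgeTab, e.inU = true ∨ e.inV = true := by
  decide

/-- A tabulated adjacency is an `HStepS` step. [cite: BollobasRiordan2006, Ch. 7 §7.2.2 pp. 168–171] -/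
theorem hStepS_of_mem {e : FEdge} (he : e ∈ edgeTab) : HStepS (faceAt e.i) (faceAt e.j) := by
  obtain ⟨hadj, hfe, hU, hV, -⟩ := edgeTab_ok e he
  refine ⟨hadj, ?_⟩
  rcases edgeTab_in e he with h | h
  · exact ⟨e.u, by rw [hfe]; exact Finset.mem_insert_self _ _, hU.1 h⟩
  · exact ⟨e.v, by rw [hfe]; exact Finset.mem_insert_of_mem (Finset.mem_singleton_self _), hV.1 h⟩

/-- An `HStepS` step out of a tabulated face is a tabulated adjacency. [cite: BollobasRiordan2006, Ch. 7 §7.2.2 pp. 168–171] -/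
theorem exists_edge_of_hStepS {x : ℕ} (hx : x < 24) {F' : HexVertex} (h : HStepS (faceAt x) F') :
    ∃ e ∈ edgeTab, e.i = x ∧ faceAt e.j = F' := by
  obtain ⟨hadj, s, hs, hsG⟩ := h
  have hF' : F' ∈ U1 := by
    have := (HStep.mem_facesOf hexBall1Five ((hStep_iff_S (faceAt x) F').2 ⟨hadj, s, hs, hsG⟩)).2
    simpa [U1] using this
  obtain ⟨e, he, hcond⟩ := List.any_eq_true.1 (edgeTab_complete x hx F' hF' hadj ⟨s, hs, hsG⟩)
  obtain ⟨hi, hj⟩ : (e.i == x) = true ∧ decide (faceAt e.j = F') = true := by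
    simpa [Bool.and_eq_true] using hcond
  exact ⟨e, he, by simpa using hi, by simpa using hj⟩

/-- Invariants of the off-interface worklist closure. [cite: BollobasRiordan2006, Ch. 7 §7.2.2 pp. 168–171] -/
theorem hGo_inv (IP : List ℕ) (P : ℕ → Prop)
    (hP : ∀ e ∈ edgeTab, e.j ∉ IP → P e.i → P e.j) :
    ∀ (fuel : ℕ) (R st : List ℕ), (∀ x ∈ R, P x) → (∀ x ∈ st, P x) → ∀ x ∈ hGo IP fuel R st, P x := by
  intro fuel
  induction fuel with
  | zero => intro R st hR _ x hx; exact hR x hx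
  | succ fuel ih =>
    intro R st hR hst
    cases st with
    | nil => intro x hx; exact hR x hx
    | cons y st =>
      simp only [hGo]
      have hy : P y := hst y List.mem_cons_self
      have hnew : ∀ x ∈ (adjL.getD y []).filterMap (fun e =>
          if !IP.elem e.j && !R.elem e.j then some e.j else none), P x := by
        intro x hx
        obtain ⟨e, he, hex⟩ := List.mem_filterMap.1 hx
        split_ifs at hex with hcond
        obtain ⟨h2, -⟩ : (e.j ∉ IP ∧ e.j ∉ R) := by simpa using hcond
        rw [Option.some.injEq] at hex
        subst hex
        obtain ⟨he', h1⟩ := mem_adjL he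
        exact hP e he' h2 (h1 ▸ hy)
      refine ih _ _ ?_ ?_
      · intro x hx
        rcases List.mem_append.1 hx with h | h
        · exact hR x h
        · exact hnew x h
      · intro x hx
        rcases List.mem_append.1 hx with h | h
        · exact hst x (List.mem_cons_of_mem _ h)
        · exact hnew x h

/-- The source belongs to the off-interface closure. [cite: BollobasRiordan2006, Ch. 7 §7.2.2 pp. 168–171] -/
theorem src_mem_hGo (IP : List ℕ) :
    ∀ (fuel : ℕ) (R st : List ℕ) (x : ℕ), x ∈ R → x ∈ hGo IP fuel R st := by
  intro fuel
  induction fuel with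
  | zero => intro R st x hx; exact hx
  | succ fuel ih =>
    intro R st x hx
    cases st with
    | nil => exact hx
    | cons y st => simp only [hGo]; exact ih _ _ x (List.mem_append_left _ hx)

/-- Indices of the joined set are in range and off the interface part. [cite: BollobasRiordan2006, Ch. 7 §7.2.2 pp. 168–171] -/
theorem jClos_lt_and_not_mem (cfg : List Bool) (r : Fin 5) (c : Bool) :
    ∀ x ∈ jClos cfg r c, x < 24 ∧ x ∉ ipClos cfg r c := by
  unfold jClos
  split_ifs with h
  · simp
  · have hsrc : ∀ x ∈ [cornerIdx r], x < 24 ∧ x ∉ ipClos cfg r c := by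
      intro x hx
      rw [List.mem_singleton] at hx
      subst hx
      exact ⟨cornerIdx_lt r, fun h' => h (List.elem_eq_true_of_mem h')⟩
    exact hGo_inv _ (fun x => x < 24 ∧ x ∉ ipClos cfg r c)
      (fun e he hj _ => ⟨(edgeTab_lt e he).2, hj⟩) 40 _ _ hsrc hsrc

/-- **Soundness of the joined-set evaluator**: every collected face is reached from `y_r` by `H_G`-steps through
faces off the interface part, and `y_r` itself is off the interface part. [cite: BollobasRiordan2006, Ch. 7 §7.2.2 pp. 168–171] -/
theorem jClos_reach (S : Finset (Site 2)) (r : Fin 5) (c : Bool)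
    (hcl : closedF (encode S) r c (ipClos (encode S) r c) = true) :
    ∀ x ∈ jClos (encode S) r c, ¬ InInterface hexBall1Five (↑S) r c (cornerT r) ∧
      Relation.ReflTransGen (fun F F' => HStep hexBall1Five F F' ∧
        ¬ InInterface hexBall1Five (↑S) r c F ∧ ¬ InInterface hexBall1Five (↑S) r c F') (cornerT r) (faceAt x) := by
  intro x hx
  have hyr : ¬ InInterface hexBall1Five (↑S) r c (cornerT r) := by
    unfold jClos at hx
    split_ifs at hx with h
    · simp at hx
    · rw [← faceAt_cornerIdx, inInterface_faceAt_iff S r c hcl (cornerIdx_lt r)]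
      exact fun h' => h (List.elem_eq_true_of_mem h')
  refine ⟨hyr, ?_⟩
  -- the invariant: in range, off IP, and reachable by the restricted relation
  have key : ∀ x ∈ jClos (encode S) r c, x < 24 ∧ x ∉ ipClos (encode S) r c ∧
      Relation.ReflTransGen (fun F F' => HStep hexBall1Five F F' ∧
        ¬ InInterface hexBall1Five (↑S) r c F ∧ ¬ InInterface hexBall1Five (↑S) r c F') (cornerT r) (faceAt x) := by
    unfold jClos
    split_ifs with h
    · simp
    · have hsrc : ∀ x ∈ [cornerIdx r], x < 24 ∧ x ∉ ipClos (encode S) r c ∧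
          Relation.ReflTransGen (fun F F' => HStep hexBall1Five F F' ∧
            ¬ InInterface hexBall1Five (↑S) r c F ∧ ¬ InInterface hexBall1Five (↑S) r c F') (cornerT r) (faceAt x) := by
        intro x hx
        rw [List.mem_singleton] at hx
        subst hx
        exact ⟨cornerIdx_lt r, fun h' => h (List.elem_eq_true_of_mem h'), by rw [faceAt_cornerIdx]⟩
      refine hGo_inv _ _ (fun e he hj hi => ?_) 40 _ _ hsrc hsrc
      obtain ⟨hi24, hiIP, hreach⟩ := hi
      have hj24 := (edgeTab_lt e he).2
      refine ⟨hj24, hj, hreach.tail ⟨(hStep_iff_S _ _).2 (hStepS_of_mem he), ?_, ?_⟩⟩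
      · rwa [inInterface_faceAt_iff S r c hcl hi24]
      · rwa [inInterface_faceAt_iff S r c hcl hj24]
  exact (key x hx).2.2

/-- **Completeness of the joined-set evaluator** from its closedness flag. [cite: BollobasRiordan2006, Ch. 7 §7.2.2 pp. 168–171] -/
theorem jClos_closed (S : Finset (Site 2)) (r : Fin 5) (c : Bool)
    (hclI : closedF (encode S) r c (ipClos (encode S) r c) = true)
    (hclJ : hClosed (ipClos (encode S) r c) (jClos (encode S) r c) = true) :
    ∀ F ∈ ((jClos (encode S) r c).map faceAt).toFinset, ∀ F',
      (HStep hexBall1Five F F' ∧ ¬ InInterface hexBall1Five (↑S) r c F ∧ ¬ InInterface hexBall1Five (↑S) r c F') →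
      F' ∈ ((jClos (encode S) r c).map faceAt).toFinset := by
  intro F hF F' hst
  rw [List.mem_toFinset, List.mem_map] at hF ⊢
  obtain ⟨x, hx, rfl⟩ := hF
  obtain ⟨hx24, hxIP⟩ := jClos_lt_and_not_mem (encode S) r c x hx
  obtain ⟨hstep, -, hF'⟩ := hst
  obtain ⟨e, he, hei, hej⟩ := exists_edge_of_hStepS hx24 ((hStep_iff_S _ _).1 hstep)
  refine ⟨e.j, ?_, hej⟩
  have hjIP : e.j ∉ ipClos (encode S) r c := by
    rw [← hej, inInterface_faceAt_iff S r c hclI (edgeTab_lt e he).2] at hF'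
    exact hF'
  have := (List.all_eq_true.1 hclJ) e he
  simp [hei] at this
  tauto

/-- **The joined set rendered**: under both flags, `Joined hexBall1Five ↑S r c F` iff `F` is a face of the
evaluator's joined set. [cite: BollobasRiordan2006, Ch. 7 §7.2.2 pp. 168–171] -/
theorem joined_iff_j (S : Finset (Site 2)) (r : Fin 5) (c : Bool) (hfl : nFlags (encode S) r c = true)
    (F : HexVertex) :
    Joined hexBall1Five (↑S) r c F ↔ F ∈ ((jClos (encode S) r c).map faceAt).toFinset := by
  obtain ⟨hclI, hclJ⟩ : closedF (encode S) r c (ipClos (encode S) r c) = true ∧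
      hClosed (ipClos (encode S) r c) (jClos (encode S) r c) = true := by
    simpa [nFlags, Bool.and_eq_true] using hfl
  constructor
  · rintro ⟨-, Y, hY, hYI, hreach⟩
    rw [isCornerFace_iff] at hY
    subst hY
    have hyr : cornerIdx r ∉ ipClos (encode S) r c := by
      rw [← faceAt_cornerIdx, inInterface_faceAt_iff S r c hclI (cornerIdx_lt r)] at hYI
      exact hYI
    refine reach_mem_of_closed (src := {cornerT r}) ?_ (jClos_closed S r c hclI hclJ)
      (Finset.mem_singleton_self _) hreach
    intro F hF
    rw [Finset.mem_singleton] at hF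
    subst hF
    rw [List.mem_toFinset, List.mem_map]
    refine ⟨cornerIdx r, ?_, faceAt_cornerIdx r⟩
    unfold jClos
    rw [if_neg (fun h => hyr (List.mem_of_elem_eq_true h))]
    exact src_mem_hGo _ _ _ _ _ (List.mem_singleton_self _)
  · intro hF
    rw [List.mem_toFinset, List.mem_map] at hF
    obtain ⟨x, hx, rfl⟩ := hF
    obtain ⟨hyr, hreach⟩ := jClos_reach S r c hclI x hx
    have hxI : ¬ InInterface hexBall1Five (↑S) r c (faceAt x) := by
      rw [inInterface_faceAt_iff S r c hclI (jClos_lt_and_not_mem _ r c x hx).1]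
      exact (jClos_lt_and_not_mem _ r c x hx).2
    exact ⟨hxI, cornerT r, (isCornerFace_iff r _).2 rfl, hyr, hreach⟩

/-- Index form of `joined_iff_j` for tabulated faces. [cite: BollobasRiordan2006, Ch. 7 §7.2.2 pp. 168–171] -/
theorem joined_faceAt_iff (S : Finset (Site 2)) (r : Fin 5) (c : Bool) (hfl : nFlags (encode S) r c = true)
    {i : ℕ} (hi : i < 24) : Joined hexBall1Five (↑S) r c (faceAt i) ↔ i ∈ jClos (encode S) r c := by
  rw [joined_iff_j S r c hfl, List.mem_toFinset, List.mem_map]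
  constructor
  · rintro ⟨x, hx, hxe⟩
    rwa [faceAt_inj x (jClos_lt_and_not_mem _ r c x hx).1 i hi hxe] at hx
  · exact fun h => ⟨i, h, rfl⟩

end Literature.Probability.Percolation.FivePoint.Rung

namespace Literature.Probability.Percolation.FivePoint.Rung

open Literature.Probability.LatticeModels Literature.Probability.Percolation.FivePoint.S0

/-! ### N6. The mid-edge probability on `hexBall1Five` as a count -/

/-- `#(triBall 1) = 7`. [cite: BollobasRiordan2006, Ch. 7 §7.2.2 pp. 168–171] -/
theorem card_triBall_one : (triBall 1).card = 7 := by decide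

open Classical in
/-- **The mid-edge probability as a count** on `hexBall1Five`:
`midEdgeProb r c x x' = #{S ⊆ triBall 1 | x or x' joined to y_r under S} / 2⁷`. [cite: BollobasRiordan2006, Ch. 7 §7.2.2 pp. 168–171] -/
theorem midEdgeProb_eq_card_div (r : Fin 5) (c : Bool) (x x' : HexVertex) :
    midEdgeProb hexBall1Five r c x x' =
      (((triBall 1).powerset.filter fun T : Finset (Site 2) =>
          Joined hexBall1Five (↑T) r c x ∨ Joined hexBall1Five (↑T) r c x').card : ℝ) / 2 ^ 7 := by
  have h := triSitePercolation_half_real_setOf_eq_card_div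
    (P := fun σ => Joined hexBall1Five σ r c x ∨ Joined hexBall1Five σ r c x') (triBall 1)
    fun σ => by
      have h1 := (joined_inter_iff hexBall1Five σ r c x).symm
      have h2 := (joined_inter_iff hexBall1Five σ r c x').symm
      rw [hexBall1Five_verts] at h1 h2
      rw [h1, h2]
  unfold midEdgeProb midEdgeEvent
  rw [← card_triBall_one]
  convert h using 4
  congr 1

/-! ### N7. Configurations: `allBits 7` enumerates the powerset of the ball -/

/-- The sub-configuration encoded by a bit list. [cite: BollobasRiordan2006, Ch. 7 §7.2.2 pp. 168–171] -/
def decode (cfg : List Bool) : Finset (Site 2) := (((List.range 7).filter fun a => bit cfg a).map ballAt).toFinset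

/-- Members of `allBits n` have length `n`. [cite: BollobasRiordan2006, Ch. 7 §7.2.2 pp. 168–171] -/
theorem length_of_mem_allBits : ∀ (n : ℕ) (l : List Bool), l ∈ allBits n → l.length = n := by
  intro n
  induction n with
  | zero => intro l hl; simp [allBits] at hl; simp [hl]
  | succ n ih =>
    intro l hl
    simp only [allBits, List.mem_flatMap, List.mem_cons, List.not_mem_nil, or_false] at hl
    obtain ⟨l', hl', h | h⟩ := hl <;> subst h <;> simp [ih l' hl']

/-- `allBits n` has no duplicates. [cite: BollobasRiordan2006, Ch. 7 §7.2.2 pp. 168–171] -/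
theorem allBits_nodup : ∀ n : ℕ, (allBits n).Nodup := by
  intro n
  induction n with
  | zero => simp [allBits]
  | succ n ih =>
    simp only [allBits]
    rw [List.nodup_flatMap]
    refine ⟨fun l _ => by simp, ?_⟩
    refine ih.pairwise_of_forall_ne fun l _ l' _ hne => ?_
    simp only [Function.onFun, List.disjoint_left, List.mem_cons, List.not_mem_nil, or_false]
    rintro b (rfl | rfl) (h | h) <;> simp only [List.cons.injEq] at h <;> exact hne h.2

/-- Decoded configurations lie in the ball. [cite: BollobasRiordan2006, Ch. 7 §7.2.2 pp. 168–171] -/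
theorem decode_subset (cfg : List Bool) : decode cfg ⊆ triBall 1 := by
  intro s hs
  unfold decode at hs
  rw [List.mem_toFinset, List.mem_map] at hs
  obtain ⟨a, ha, rfl⟩ := hs
  rw [List.mem_filter, List.mem_range] at ha
  exact ballAt_mem a ha.1

/-- Membership in a decoded configuration. [cite: BollobasRiordan2006, Ch. 7 §7.2.2 pp. 168–171] -/
theorem ballAt_mem_decode {cfg : List Bool} {a : ℕ} (ha : a < 7) : ballAt a ∈ decode cfg ↔ bit cfg a = true := by
  unfold decode
  rw [List.mem_toFinset, List.mem_map]
  constructor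
  · rintro ⟨b, hb, hba⟩
    rw [List.mem_filter, List.mem_range] at hb
    rw [← ballAt_inj b hb.1 a ha hba]
    exact hb.2
  · intro h
    exact ⟨a, List.mem_filter.2 ⟨List.mem_range.2 ha, h⟩, rfl⟩

/-- `encode ∘ decode = id` on `allBits 7`. [cite: BollobasRiordan2006, Ch. 7 §7.2.2 pp. 168–171] -/
theorem encode_decode {cfg : List Bool} (hcfg : cfg ∈ allBits 7) : encode (decode cfg) = cfg := by
  have hlen := length_of_mem_allBits 7 cfg hcfg
  apply List.ext_getElem?
  intro a
  by_cases ha : a < 7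
  · have e1 : (encode (decode cfg))[a]? = some (decide (ballAt a ∈ decode cfg)) := by
      simp [encode, List.getElem?_range ha]
    have e2 : cfg[a]? = some (bit cfg a) := by
      rw [bit, List.getD_eq_getElem?_getD, List.getElem?_eq_getElem (by omega)]
      rfl
    rw [e1, e2]
    cases h : bit cfg a
    · rw [decide_eq_false]
      rw [ballAt_mem_decode ha, h]
      exact Bool.false_ne_true
    · rw [decide_eq_true ((ballAt_mem_decode ha).2 h)]
  · rw [List.getElem?_eq_none (by simp [encode]; omega), List.getElem?_eq_none (by omega)]

/-- `decode ∘ encode = id` on sub-configurations of the ball. [cite: BollobasRiordan2006, Ch. 7 §7.2.2 pp. 168–171] -/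
theorem decode_encode {T : Finset (Site 2)} (hT : T ⊆ triBall 1) : decode (encode T) = T := by
  ext s
  constructor
  · intro hs
    have hs' := decode_subset _ hs
    obtain ⟨a, ha, rfl⟩ := exists_ballAt s hs'
    rw [ballAt_mem_decode ha, bit_encode T ha, decide_eq_true_iff] at hs
    exact hs
  · intro hs
    obtain ⟨a, ha, rfl⟩ := exists_ballAt s (hT hs)
    rw [ballAt_mem_decode ha, bit_encode T ha, decide_eq_true_iff]
    exact hs

/-- **A powerset count is a count over `allBits 7`.** [cite: BollobasRiordan2006, Ch. 7 §7.2.2 pp. 168–171] -/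
theorem card_filter_powerset_eq_countP (P : Finset (Site 2) → Prop) [DecidablePred P] (Q : List Bool → Bool)
    (h : ∀ T ⊆ triBall 1, P T ↔ Q (encode T) = true) :
    ((triBall 1).powerset.filter P).card = (allBits 7).countP Q := by
  rw [List.countP_eq_length_filter, ← List.toFinset_card_of_nodup ((allBits_nodup 7).filter Q),
    List.toFinset_filter]
  have himg : ((triBall 1).powerset.filter P).image encode = ((allBits 7).toFinset.filter fun x => Q x = true) := by
    ext cfg
    rw [Finset.mem_image, Finset.mem_filter, List.mem_toFinset]
    constructor
    · rintro ⟨T, hT, rfl⟩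
      rw [Finset.mem_filter, Finset.mem_powerset] at hT
      exact ⟨encode_mem T, (h T hT.1).1 hT.2⟩
    · rintro ⟨hcfg, hQ⟩
      refine ⟨decode cfg, ?_, encode_decode hcfg⟩
      rw [Finset.mem_filter, Finset.mem_powerset]
      refine ⟨decode_subset cfg, (h _ (decode_subset cfg)).2 ?_⟩
      rwa [encode_decode hcfg]
  rw [← himg, Finset.card_image_of_injOn]
  intro T hT T' hT' hTT'
  rw [Finset.coe_filter, Set.mem_setOf_eq, Finset.mem_powerset] at hT hT'
  rw [← decode_encode hT.1, ← decode_encode hT'.1, hTT']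

/-! ### N8. The tally -/

/-- `addRow` keeps the length when the row is long enough. [cite: BollobasRiordan2006, Ch. 7 §7.2.2 pp. 168–171] -/
theorem length_addRow (acc : List ℕ) (row : List Bool) (h : acc.length ≤ row.length) :
    (addRow acc row).length = acc.length := by
  simp [addRow, List.length_zipWith, h]

/-- Entries of `addRow`. [cite: BollobasRiordan2006, Ch. 7 §7.2.2 pp. 168–171] -/
theorem getD_addRow (acc : List ℕ) (row : List Bool) {k : ℕ} (hk : k < acc.length) (hk' : k < row.length) :
    (addRow acc row).getD k 0 = acc.getD k 0 + (if row.getD k false then 1 else 0) := by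
  unfold addRow
  rw [List.getD_eq_getElem?_getD, List.getElem?_zipWith, List.getElem?_eq_getElem hk,
    List.getElem?_eq_getElem hk', List.getD_eq_getElem?_getD, List.getD_eq_getElem?_getD,
    List.getElem?_eq_getElem hk, List.getElem?_eq_getElem hk']
  simp only [Option.getD_some]
  split_ifs <;> rfl

/-- **Column `k` of the tally counts the rows whose entry `k` is `true`.** [cite: BollobasRiordan2006, Ch. 7 §7.2.2 pp. 168–171] -/
theorem tally_getD (rows : List (List Bool)) (n k : ℕ) (hk : k < n) (hlen : ∀ row ∈ rows, row.length = n) :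
    (tally rows n).getD k 0 = rows.countP fun row => row.getD k false := by
  unfold tally
  suffices key : ∀ acc : List ℕ, acc.length = n →
      (rows.foldl addRow acc).getD k 0 = acc.getD k 0 + rows.countP fun row => row.getD k false by
    rw [key _ (List.length_replicate ..), List.getD_eq_getElem?_getD, List.getElem?_replicate]
    simp [hk]
  induction rows with
  | nil => intro acc _; simp
  | cons row rows ih =>
    intro acc hacc
    have hrow : row.length = n := hlen row List.mem_cons_self
    rw [List.foldl_cons, ih (fun r hr => hlen r (List.mem_cons_of_mem _ hr)) _ (by
      rw [length_addRow _ _ (by omega), hacc]), getD_addRow _ _ (by omega) (by omega),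
      List.countP_cons]
    split_ifs <;> omega

/-- Rows have the length of the inner-edge table. [cite: BollobasRiordan2006, Ch. 7 §7.2.2 pp. 168–171] -/
theorem length_nRow (c : Bool) (p : List Bool × Fin 5) : (nRow c p).length = innerTab.length := by
  simp [nRow]

/-- The inner-edge table has `18` entries. [cite: BollobasRiordan2006, Ch. 7 §7.2.2 pp. 168–171] -/
theorem length_innerTab : innerTab.length = 18 := by rfl

/-- Entry `k` of a row. [cite: BollobasRiordan2006, Ch. 7 §7.2.2 pp. 168–171] -/
theorem getD_nRow (c : Bool) (cfg : List Bool) (r : Fin 5) {k : ℕ} {i i' : ℕ} (hk : innerTab[k]? = some (i, i')) :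
    (nRow c (cfg, r)).getD k false = ((jClos cfg r c).elem i || (jClos cfg r c).elem i') := by
  unfold nRow
  rw [List.getD_eq_getElem?_getD, List.getElem?_map, hk]
  rfl

/-- **Column `k` of the tally at `(c, r)`** = the number of configurations under which a face of the `k`-th inner
edge is joined to `y_r` (index form). [cite: BollobasRiordan2006, Ch. 7 §7.2.2 pp. 168–171] -/
theorem nTallyAt_getD (c : Bool) (r : Fin 5) {k i i' : ℕ} (hk : innerTab[k]? = some (i, i')) :
    (nTallyAt c r).getD k 0 =
      (allBits 7).countP fun cfg => ((jClos cfg r c).elem i || (jClos cfg r c).elem i') := by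
  unfold nTallyAt
  have hk18 : k < innerTab.length := (List.getElem?_eq_some_iff.1 hk).1
  rw [tally_getD _ _ _ hk18 (fun row hrow => by
    obtain ⟨p, -, rfl⟩ := List.mem_map.1 hrow; exact length_nRow c (p, r)), List.countP_map]
  congr 1
  funext cfg
  exact getD_nRow c cfg r hk

/-! ### N9. The inner edges: completeness of the table -/

/-- Inner-edge indices are in range. [cite: BollobasRiordan2006, Ch. 7 §7.2.2 pp. 168–171] -/
theorem innerTab_lt : ∀ e ∈ innerTab, e.1 < 24 ∧ e.2 < 24 := by decide

/-- A face whose three vertices lie in the ball is a face of `U1`, and so is any face adjacent to it across a bond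
of the ball. [cite: BollobasRiordan2006, Ch. 7 §7.2.2 pp. 168–171] -/
theorem mem_U1_of_subset {x : HexVertex} (hx : hexFaceVertices x ⊆ triBall 1) : x ∈ U1 := by
  unfold U1
  rw [mem_facesOf_iff]
  exact ⟨faceVertex x 0, faceVertex_mem x 0, hx (faceVertex_mem x 0)⟩

/-- A face adjacent across a bond of the ball is a face of `U1`. [cite: BollobasRiordan2006, Ch. 7 §7.2.2 pp. 168–171] -/
theorem mem_U1_of_faceEdge_subset {x x' : HexVertex} (hadj : hexGraph.Adj x x') (he : faceEdge x x' ⊆ triBall 1) :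
    x' ∈ U1 := by
  unfold U1
  rw [mem_facesOf_iff]
  have hcard : (faceEdge x x').card = 2 := ((hexGraph_adj_iff x x').1 hadj).2
  obtain ⟨s, hs⟩ : (faceEdge x x').Nonempty := by
    rw [← Finset.card_pos, hcard]; norm_num
  exact ⟨s, (Finset.mem_inter.1 hs).2, he hs⟩

/-- **Completeness of the inner-edge table**: every inner edge `{x, x'}` of `H_G` (`x` interior, `x'` across a bond
of `G`) is tabulated. [cite: BollobasRiordan2006, Ch. 7 §7.2.2 pp. 168–171] -/
theorem innerTab_complete : ∀ x ∈ U1, ∀ x' ∈ U1, hexFaceVertices x ⊆ triBall 1 → hexGraph.Adj x x' →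
    faceEdge x x' ⊆ triBall 1 →
      (innerTab.any fun e => decide (faceAt e.1 = x) && decide (faceAt e.2 = x')) = true := by
  decide

/-- An inner edge as a table position. [cite: BollobasRiordan2006, Ch. 7 §7.2.2 pp. 168–171] -/
theorem exists_innerTab {x x' : HexVertex} (hx : hexFaceVertices x ⊆ triBall 1) (hadj : hexGraph.Adj x x')
    (he : faceEdge x x' ⊆ triBall 1) :
    ∃ k i i' : ℕ, innerTab[k]? = some (i, i') ∧ faceAt i = x ∧ faceAt i' = x' := by
  have := innerTab_complete x (mem_U1_of_subset hx) x' (mem_U1_of_faceEdge_subset hadj he) hx hadj he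
  obtain ⟨e, he', hcond⟩ := List.any_eq_true.1 this
  obtain ⟨h1, h2⟩ : decide (faceAt e.1 = x) = true ∧ decide (faceAt e.2 = x') = true := by
    simpa [Bool.and_eq_true] using hcond
  obtain ⟨k, hk, hke⟩ := List.mem_iff_getElem.1 he'
  exact ⟨k, e.1, e.2, by rw [List.getElem?_eq_getElem hk, hke], by simpa using h1, by simpa using h2⟩

/-! ### N10. Assembly -/

/-- The flags and counts of one `(c, r)`, unpacked. [cite: BollobasRiordan2006, Ch. 7 §7.2.2 pp. 168–171] -/
theorem nCheckAt_sound {c : Bool} {r : Fin 5} (h : nCheckAt c r = true) :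
    (∀ cfg ∈ allBits 7, nFlags cfg r c = true) ∧ nTallyAt c r = nExpected c r := by
  unfold nCheckAt nFlagsAt at h
  rw [Bool.and_eq_true, List.all_eq_true, beq_iff_eq] at h
  exact h

open Classical in
/-- **Per-corner count**: under the checker, the number of `S ⊆ triBall 1` with `x` or `x'` joined to `y_r` is the
tabulated entry. [cite: BollobasRiordan2006, Ch. 7 §7.2.2 pp. 168–171] -/
theorem card_joined_eq (c : Bool) (r : Fin 5) (h : nCheckAt c r = true) {k i i' : ℕ}
    (hk : innerTab[k]? = some (i, i')) :
    ((triBall 1).powerset.filter fun T : Finset (Site 2) =>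
        Joined hexBall1Five (↑T) r c (faceAt i) ∨ Joined hexBall1Five (↑T) r c (faceAt i')).card =
      (nExpected c r).getD k 0 := by
  obtain ⟨hfl, htal⟩ := nCheckAt_sound h
  obtain ⟨hi, hi'⟩ := innerTab_lt (i, i') (List.mem_of_getElem? hk)
  rw [← htal, nTallyAt_getD c r hk]
  refine card_filter_powerset_eq_countP _ _ fun T hT => ?_
  have hflT := hfl (encode T) (encode_mem T)
  rw [joined_faceAt_iff T r c hflT hi, joined_faceAt_iff T r c hflT hi', Bool.or_eq_true,
    List.elem_iff, List.elem_iff]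

/-- The expected table: every column sums to `128`. [cite: BollobasRiordan2006, Ch. 7 §7.2.2 pp. 168–171] -/
theorem nExpected_colsum (c : Bool) : ∀ k < 18, ∑ r : Fin 5, (nExpected c r).getD k 0 = 128 := by
  unfold nExpected
  decide

/-- **(N) on `hexBall1Five` from the checker.** [cite: BollobasRiordan2006, Ch. 7 §7.2.2 pp. 168–171] -/
theorem normalisation_of_nCheck (hN : ∀ c r, nCheckAt c r = true) (c : Bool) (x x' : HexVertex)
    (hx : hexFaceVertices x ⊆ hexBall1Five.verts) (hadj : hexGraph.Adj x x')
    (he : faceEdge x x' ⊆ hexBall1Five.verts) :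
    ∑ r : Fin 5, midEdgeProb hexBall1Five r c x x' = 1 := by
  rw [hexBall1Five_verts] at hx he
  obtain ⟨k, i, i', hk, rfl, rfl⟩ := exists_innerTab hx hadj he
  have hk18 : k < 18 := by
    have := (List.getElem?_eq_some_iff.1 hk).1
    rwa [length_innerTab] at this
  simp_rw [midEdgeProb_eq_card_div, card_joined_eq c _ (hN c _) hk]
  rw [← Finset.sum_div]
  have hsum := nExpected_colsum c k hk18
  have : (∑ r : Fin 5, ((nExpected c r).getD k 0 : ℝ)) = 128 := by exact_mod_cast hsum
  rw [this]
  norm_num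

end Literature.Probability.Percolation.FivePoint.Rung

namespace Literature.Probability.Percolation.FivePoint.Rung

open Literature.Probability.LatticeModels

/-! ### N11. Kernel evaluation of the (N) checker (standard axioms) and the theorem -/

/-- `(c, r) = (false, 0)`. [cite: BollobasRiordan2006, Ch. 7 §7.2.2 pp. 168–171] -/ theorem nCheckAt_f0 : nCheckAt false 0 = true := by decide +kernel
/-- `(c, r) = (false, 1)`. [cite: BollobasRiordan2006, Ch. 7 §7.2.2 pp. 168–171] -/ theorem nCheckAt_f1 : nCheckAt false 1 = true := by decide +kernel
/-- `(c, r) = (false, 2)`. [cite: BollobasRiordan2006, Ch. 7 §7.2.2 pp. 168–171] -/ theorem nCheckAt_f2 : nCheckAt false 2 = true := by decide +kernel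
/-- `(c, r) = (false, 3)`. [cite: BollobasRiordan2006, Ch. 7 §7.2.2 pp. 168–171] -/ theorem nCheckAt_f3 : nCheckAt false 3 = true := by decide +kernel
/-- `(c, r) = (false, 4)`. [cite: BollobasRiordan2006, Ch. 7 §7.2.2 pp. 168–171] -/ theorem nCheckAt_f4 : nCheckAt false 4 = true := by decide +kernel
/-- `(c, r) = (true, 0)`. [cite: BollobasRiordan2006, Ch. 7 §7.2.2 pp. 168–171] -/ theorem nCheckAt_t0 : nCheckAt true 0 = true := by decide +kernel
/-- `(c, r) = (true, 1)`. [cite: BollobasRiordan2006, Ch. 7 §7.2.2 pp. 168–171] -/ theorem nCheckAt_t1 : nCheckAt true 1 = true := by decide +kernel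
/-- `(c, r) = (true, 2)`. [cite: BollobasRiordan2006, Ch. 7 §7.2.2 pp. 168–171] -/ theorem nCheckAt_t2 : nCheckAt true 2 = true := by decide +kernel
/-- `(c, r) = (true, 3)`. [cite: BollobasRiordan2006, Ch. 7 §7.2.2 pp. 168–171] -/ theorem nCheckAt_t3 : nCheckAt true 3 = true := by decide +kernel
/-- `(c, r) = (true, 4)`. [cite: BollobasRiordan2006, Ch. 7 §7.2.2 pp. 168–171] -/ theorem nCheckAt_t4 : nCheckAt true 4 = true := by decide +kernel

/-- All ten `(c, r)` checks. [cite: BollobasRiordan2006, Ch. 7 §7.2.2 pp. 168–171] -/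
theorem nCheckAt_all : ∀ (c : Bool) (r : Fin 5), nCheckAt c r = true := by
  intro c r
  cases c <;> fin_cases r
  · exact nCheckAt_f0
  · exact nCheckAt_f1
  · exact nCheckAt_f2
  · exact nCheckAt_f3
  · exact nCheckAt_f4
  · exact nCheckAt_t0
  · exact nCheckAt_t1
  · exact nCheckAt_t2
  · exact nCheckAt_t3
  · exact nCheckAt_t4

/-- ★ **THE (N) RUNG: the five-point normalisation holds on the smallest five-marked domain `hexBall1Five`** — for
every colour `c` and every inner edge `{x, x'}` of `H_G` (`x` an interior face, `x'` adjacent across a bond of `G`),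
`Σ_{r : Fin 5} P_{1/2}[x or x' is joined to the corner of v_r under (r, c)] = 1`: the D1-v2 conjecture
`HexFivePointNormalisation` specialised to `D := hexBall1Five`, decided by the kernel on standard axioms
(2 colours × 18 ordered inner edges × 5 corners × 2⁷ colourings). [cite: KhristoforovSmirnov2021, §1.2 Lemma 2] -/
theorem hexFivePointNormalisation_hexBall1Five (c : Bool) (x x' : HexVertex)
    (hx : hexFaceVertices x ⊆ hexBall1Five.verts) (hadj : hexGraph.Adj x x') (he : faceEdge x x' ⊆ hexBall1Five.verts) :
    ∑ r : Fin 5, midEdgeProb hexBall1Five r c x x' = 1 :=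
  normalisation_of_nCheck nCheckAt_all c x x' hx hadj he

end Literature.Probability.Percolation.FivePoint.Rung

end
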